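import Summits.ResolutionOfSingularities.ResolutionOfSingularities.Theorems.CompanionPresentation
import HarnessLib

/-!
# CompanionTransport — decomp-res node «CompanionCut» (lens-4 g26, critic row 154), tree file 4/7 of the node

Content VERBATIM from the decomp-res lens-4 g26 node `HOME/decomp-res-lens-4/g26/CompanionCut.lean` (pin 12d9bf52, 1
262 l, 56 declarations;
HOME = run/shared/lean/pub/decomp-res) = ONE NEW PART §66–§70, NO CARRY, on top of the landed
`Theorems/HeightCutCells` (g25) +
`Theorems/MaxContactCutKangarooCut` (h71 wiring) + `Theorems/ContactFreeIsPPower` (lens-6).  Critic: CRITIC-LEDGER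
row 154 (CLEARED
2026-08-30T23:45:15Z, DECIDED +1 (ii*): THE COMPANION LAW at every weight — Hasse descent of a `p^e`-power form to
a weight-`p^e`
companion with LINEAR weak contact, Giraud transport with a typed jump dichotomy in every weight, the deciding implication
«eventually companion-jump-free ⇒ 31571's class» and the EXACT re-location of the g25 residual
`NoWildKangarooOffDoublePointTowers`
to the companion-recurrent towers `NoWildCompanionKangarooTowers`; inhabitants both sides).  Landing orders INBOX
:519 (lens-4 g26
landing note, split per NEXT-g27 §4) and :528 (critic): `--kind proof --supports
stmt-ResolutionOfSingularities-28338`, namespace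
`…Theorems.HugValuationCut`.  Landed by decomp-res writer g8 CONE-AWARE in seven files: `CompanionAlgebra` ·
`CompanionHasse` ·
`CompanionPresentation` (§66–§67) · `CompanionTransport` (§68) · `CompanionTowers` (§69) ·
`CompanionCutCells` (§70 cone-free cells and
hypothesis-free re-locations) are OUTSIDE the Theses cone (importable by the route file); the five §70 corollaries GIVEN 31571
`MaxContactCut.NoContactHuggingTowers` BY NAME are the in-cone wiring file `MaxContactCutCompanionCut`.  Aside
bookkeeping (row 154):
ONE successor aside on the lens-4 column, `NoWildCompanionKangarooTowers` (home `CompanionCutCells`) SUPERSEDING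
`HCNoWildKangarooOffDoublePointTowers` (g25, route rev 43); exactness `noWildKangarooOffDoublePointTowers_iff_companion (h71)`;
the decided cell `NoWildCompanionJumpFreeTowers` (⟸ 31571, `noWildCompanionJumpFreeTowers_of_item`) is not filed.

§68 (l. 715–948) GIRAUD TRANSPORT OF THE COMPANION under a point blow-up (every weight `1 ≤ w ≤ n`, every
scheme, universe `uC`):
`CInv`, `CTailJumpAt` (NEW OBJECTS, support definitions), `cInv_self_iff_wInv`, `cInv_one_of_absInv`, `giraud_point_shift`,
`cInv_point_transport`, `cInv_or_cTailJumpAt_point` (L2).  PROVED, 0 sorry.  Imports `CompanionPresentation`.  Cone-free.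

[WRITER NOTE (decomp-res writer g8): section split only (400-line cap; §66 `section CompanionAlgebra` is re-opened
with the same
`variable` lines in `CompanionHasse` / `CompanionPresentation`); namespace, universes, section variables and every
declaration exactly
as in the lens (global `set_option` dropped; the lens's in-cone import `MaxContactCutKangarooCut` and the `open
…Theses` line live only
in the wiring file `MaxContactCutCompanionCut`).]

(Sources: Giraud1975 Thm 5.2; EncinasVillamayor2000 Thm 4.9; BravoGarciaEscamillaEncinasVillamayor2012 Lemma 4.6;
KawanoueMatsuki2010; Kawanoue arXiv:math/0607009; CossartPiltant2008 §2; Cossart2011 ex. III.2; Hauser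
arXiv:0811.4151; FruehbisKrueger arXiv:1007.2203 §3; BenitoVillamayor arXiv:1004.1803; Lucas 1878.)
-/

noncomputable section

open CategoryTheory AlgebraicGeometry IsLocalRing
open Literature.AlgebraicGeometry.Resolution
open Summit.ResolutionOfSingularities.ResolutionOfSingularities.Theorems
open WeakOrderReduction ForcedTowerClasses DivergentTowerClasses MonomialTowerClasses
open HugDimensionClasses HugDimensionKernels SurfaceShadowClasses SurfaceShadowKernels
open NearPointCut (SingularClass)
open AbsoluteContactClasses (IsAbsContactAt SepResidueAt diffIdeal_restrict_le stalkMap_comp_toStalk_eq_stalkHom)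
open scoped BigOperators

namespace Summit.ResolutionOfSingularities.ResolutionOfSingularities.Theorems.HugValuationCut

/-! ## §68 GIRAUD TRANSPORT OF THE COMPANION under a point blow-up (every weight `1 ≤ w ≤ n`, every scheme) -/

section CompanionTransport

universe uC

variable {X X' : Scheme.{uC}} {π : X' ⟶ X} {C : X.IdealSheafData}

/-- **`CInv w 𝓘 H n y` — THE COMPANION STAGE INVARIANT along the germ ideal `H`** (NEW OBJECT): `H_y = (z)` with `z` a
regular parameter through `y`, and some `g ∈ Diff^{≤ n−w}_ℤ(𝓘_y)`, `c` a unit, with `g − c·z^w ∈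
𝔪_y^{w+1}` — the weight-`w`
companion has linear weak contact ALONG `V(H)`.  `w = n`: g24's `WInv` (`Diff^{≤0}(𝓘) = 𝓘`); `w = 1` ⟸
lens-6's `AbsInv`.
DEFINITION (support). -/
def CInv {Y : Scheme.{uC}} (w : ℕ) (I H : Y.IdealSheafData) (n : ℕ) (y : Y) : Prop :=
  ∃ z : Y.presheaf.stalk y, stalkIdeal H y = Ideal.span {z} ∧ z ∈ maximalIdeal (Y.presheaf.stalk y) ∧
    z ∉ maximalIdeal (Y.presheaf.stalk y) ^ 2 ∧
    ∃ g ∈ diffIdeal ℤ (n - w) (stalkIdeal I y), ∃ c : Y.presheaf.stalk y, IsUnit c ∧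
      g - c * z ^ w ∈ maximalIdeal (Y.presheaf.stalk y) ^ (w + 1)

/-- **`CTailJumpAt w 𝓘 H E n y` — A COMPANION KANGAROO JUMP AT `y`, TYPED** (NEW OBJECT): `H_y = (z')`, `z'` a regular
parameter, and some `g ∈ Diff^{≤ n−w}_ℤ(𝓘_y)`, `c'` a unit, whose `z'^w`-tail lies in the exceptional
ideal `E_y` but NOT in
`𝔪_y^{w+1}`: the companion's weight-`w` initial form has JUMPED off `c̄·Z'^w` by an exceptionally divisible correction
(`w = n`: g24's `TailJumpAt`). DEFINITION (support). -/
def CTailJumpAt {Y : Scheme.{uC}} (w : ℕ) (I H E : Y.IdealSheafData) (n : ℕ) (y : Y) : Prop :=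
  ∃ z' : Y.presheaf.stalk y, stalkIdeal H y = Ideal.span {z'} ∧ z' ∈ maximalIdeal (Y.presheaf.stalk y) ∧
    z' ∉ maximalIdeal (Y.presheaf.stalk y) ^ 2 ∧
    ∃ g ∈ diffIdeal ℤ (n - w) (stalkIdeal I y), ∃ c' : Y.presheaf.stalk y, IsUnit c' ∧
      g - c' * z' ^ w ∈ stalkIdeal E y ∧ g - c' * z' ^ w ∉ maximalIdeal (Y.presheaf.stalk y) ^ (w + 1)

/-- `w = n`: the companion invariant IS g24's weak-contact invariant (`Diff^{≤0}_ℤ(𝓘_y) = 𝓘_y`). [folklore] -/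
theorem cInv_self_iff_wInv {Y : Scheme.{uC}} (I H : Y.IdealSheafData) (n : ℕ) (y : Y) :
    CInv n I H n y ↔ WInv I H n y := by
  simp only [CInv, WInv, Nat.sub_self, diffIdeal_zero]

/-- `w = 1`: lens-6's absolute-contact invariant gives the companion invariant of weight `1` (`g := z`, `c := 1`). [folklore] -/
theorem cInv_one_of_absInv {Y : Scheme.{uC}} {I H : Y.IdealSheafData} {n : ℕ} {y : Y}
    (h : AbsoluteContactClasses.AbsInv I H (n - 1) y) : CInv 1 I H n y := by
  obtain ⟨z, hHz, hzD, hz1, hz2⟩ := h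
  exact ⟨z, hHz, hz1, hz2, z, hzD, 1, isUnit_one, by simp⟩

/-- the companion invariant gives companion contact at the point. [folklore] -/
theorem companionContactAt_of_cInv {Y : Scheme.{0}} {w n : ℕ} {I H : Y.IdealSheafData} {y : Y} (h : CInv w I H n y) :
    CompanionContactAt w n I y := by
  obtain ⟨z, -, hz1, hz2, g, hgD, c, hc, hgz⟩ := h
  obtain ⟨u, rfl⟩ := hc
  refine ⟨z, hz1, hz2, ↑u⁻¹ * g, Ideal.mul_mem_left _ _ hgD, ?_⟩
  have : ↑u⁻¹ * g - z ^ w = ↑u⁻¹ * (g - ↑u * z ^ w) := by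
    rw [mul_sub, ← mul_assoc, Units.inv_mul, one_mul]
  rw [this]
  exact Ideal.mul_mem_left _ _ hgz

/-- the companion invariant puts the point on the germ: `CInv w 𝓘 H n y → y ∈ V(H)`. [folklore] -/
theorem mem_support_of_cInv {Y : Scheme.{uC}} {w n : ℕ} {I H : Y.IdealSheafData} {y : Y} (h : CInv w I H n y) :
    y ∈ (H.support : Set Y) := by
  obtain ⟨z, hHz, hzm, -, -⟩ := h
  exact (mem_support_iff_stalkIdeal_le _ _).mpr (by rw [hHz]; exact (Ideal.span_singleton_le_iff_mem _).mpr hzm)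

/-- the companion invariant makes the germ a REGULAR HYPERSURFACE germ: `ord_y H = 1`. [folklore] -/
theorem idealOrder_eq_one_of_cInv {Y : Scheme.{uC}} {w n : ℕ} {I H : Y.IdealSheafData} {y : Y} (h : CInv w I H n y) :
    idealOrder H y = 1 := by
  obtain ⟨z, hHz, hzm, hz2, -⟩ := h
  refine le_antisymm ?_ ?_
  · by_contra hlt
    rw [not_le] at hlt
    have h2 : ((2 : ℕ) : ℕ∞) ≤ idealOrder H y := by
      have : (1 : ℕ∞) + 1 ≤ idealOrder H y := (ENat.add_one_le_iff (ENat.coe_ne_top 1)).mpr hlt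
      exact_mod_cast this
    rw [le_idealOrder_iff, hHz] at h2
    exact hz2 (h2 (Ideal.mem_span_singleton_self z))
  · rw [show (1 : ℕ∞) = ((1 : ℕ) : ℕ∞) from rfl, le_idealOrder_iff, hHz, pow_one]
    exact (Ideal.span_singleton_le_iff_mem _).mpr hzm

/-- **GIRAUD'S LEMMA OVER `ℤ` WITH A SHIFT, point round (KERNEL, PROVED)** — the tree's stalk shift law
`t^a·π^*(D h) = t^N·Δ(w)` (`π^*h = t^N w`, `D ∈ Diff^{≤a}`, BGEV2012 Lemma 4.6) read for `a ≤ N`: with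
`C_x = 𝔪_x`, `E_y = (t)`,
`t = π^*𝔷` a non-zero-divisor and `𝓘_x ⊆ 𝔪_x^N`, if `z ∈ Diff^{≤a}_ℤ(𝓘_x)` and `π^*z = t^{N−a}·z'` then
`z' ∈ Diff^{≤a}_ℤ(𝓘'_y)`, `𝓘' = (π^{-1}𝓘 : E^N)` — THE WEIGHT-`(N−a)` COMPANION TRANSFORMS INTO
THE COMPANION (Giraud).
(`a = N − 1`: lens-6's `giraud_point`.) (Sources: BravoGarciaEscamillaVillamayor2012, Lemma 4.6; Giraud1975;
EncinasVillamayor2000, Thm. 4.9; Kawanoue2007, Ch. 4.) -/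
theorem giraud_point_shift (hπ : IsBlowup π C) (y : X') [IsNoetherianRing (X.presheaf.stalk (π y))]
    (hC : stalkIdeal C (π y) = maximalIdeal (X.presheaf.stalk (π y)))
    (𝔷 : X.presheaf.stalk (π y)) (hE : stalkIdeal (C.comap π) y = Ideal.span {(π.stalkMap y).hom 𝔷})
    (hnzd : (π.stalkMap y).hom 𝔷 ∈ nonZeroDivisors (X'.presheaf.stalk y))
    (I : X.IdealSheafData) {a N : ℕ} (haN : a ≤ N) (hIN : stalkIdeal I (π y) ≤ maximalIdeal _ ^ N)
    {z : X.presheaf.stalk (π y)} (hz : z ∈ diffIdeal ℤ a (stalkIdeal I (π y)))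
    {z' : X'.presheaf.stalk y} (hzz' : (π.stalkMap y).hom z = (π.stalkMap y).hom 𝔷 ^ (N - a) * z') :
    z' ∈ diffIdeal ℤ a (stalkIdeal (controlledTransform π C I N) y) := by
  set σ := (π.stalkMap y).hom with hσ
  set t := σ 𝔷 with ht
  have hfg : (stalkIdeal C (π y)).FG := by
    rw [hC]; exact (isNoetherianRing_iff_ideal_fg _).mp inferInstance _
  have key := hπ.exists_isDiffOpLE_stalk_shift (Int.castRingHom Γ(X, ⊤)) y hfg 𝔷 hE.symm
  have e1 : stalkAlgebra (Int.castRingHom Γ(X, ⊤)) (π y) = Ring.toIntAlgebra _ := Subsingleton.elim _ _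
  have e2 : stalkAlgebra (π.appTop.hom.comp (Int.castRingHom Γ(X, ⊤))) y = Ring.toIntAlgebra _ :=
    Subsingleton.elim _ _
  rw [e1, e2] at key
  have hI' : stalkIdeal (controlledTransform π C I N) y =
      Submodule.colon ((stalkIdeal I (π y)).map σ) {t ^ N} := by
    rw [hπ.stalkIdeal_controlledTransform I N y, stalkIdeal_comap_eq_map_stalkMap, hE,
      Ideal.span_singleton_pow, Submodule.colon_span]
  have hNa : t ^ N = t ^ a * t ^ (N - a) := by rw [← pow_add, Nat.add_sub_cancel' haN]
  have hle : diffIdeal ℤ a (stalkIdeal I (π y)) ≤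
      (Ideal.span {t ^ (N - a)} * diffIdeal ℤ a (stalkIdeal (controlledTransform π C I N) y)).comap σ := by
    rw [diffIdeal_le_iff]
    intro D hD h hh
    rw [Ideal.mem_comap]
    obtain ⟨Δ, hΔ, hshift⟩ := key a N D hD
    have h3 : σ h ∈ Ideal.span {t ^ N} := by
      have hm : σ h ∈ (maximalIdeal _ ^ N).map σ := Ideal.mem_map_of_mem _ (hIN hh)
      rw [Ideal.map_pow, ← hC, ← stalkIdeal_comap_eq_map_stalkMap, hE, Ideal.span_singleton_pow] at hm
      exact hm
    obtain ⟨w, hw⟩ := Ideal.mem_span_singleton'.mp h3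
    have hwI' : w ∈ stalkIdeal (controlledTransform π C I N) y := by
      rw [hI', Submodule.mem_colon_singleton, smul_eq_mul, hw]
      exact Ideal.mem_map_of_mem _ hh
    have hsh := hshift h w (by rw [← hw, mul_comm])
    have hDh : σ (D h) = t ^ (N - a) * Δ w := by
      have h2 : t ^ a * σ (D h) = t ^ a * (t ^ (N - a) * Δ w) := by rw [hsh, hNa]; ring
      exact (mul_cancel_left_mem_nonZeroDivisors (pow_mem hnzd a)).mp h2
    rw [hDh]
    exact Ideal.mul_mem_mul (Ideal.mem_span_singleton_self _) (apply_mem_diffIdeal ℤ hΔ hwI')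
  have hz' : σ z ∈ Ideal.span {t ^ (N - a)} * diffIdeal ℤ a (stalkIdeal (controlledTransform π C I N) y) := hle hz
  rw [hzz', Ideal.mem_span_singleton_mul] at hz'
  obtain ⟨b, hb, hbe⟩ := hz'
  have : b = z' := (mul_cancel_left_mem_nonZeroDivisors (pow_mem hnzd _)).mp hbe
  rw [← this]; exact hb

/-- **THE COMPANION TRANSPORT LAW UNDER A POINT BLOW-UP (KERNEL, PROVED, scheme level, ANY weight `1 ≤ w ≤ n`,
ANY scheme)**:
`X` regular locally Noetherian, `π` the blowing up of the closed point `x = π y` (`V(C) = {x}` a regular subscheme),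
`𝓘_x ⊆ 𝔪_x^n`, `𝓘' = (π^{-1}𝓘 : E^n)` with `𝓘'_y ⊆ 𝔪_y^{n−w+1}` (the marking is kept), and
`CInv w 𝓘 H n x`.  THEN along the
strict transform `H'` of `H`: `H'_y = (z')` with `z'` a REGULAR PARAMETER through `y`, and the transported companion element
`g' ∈ Diff^{≤ n−w}_ℤ(𝓘'_y)` (GIRAUD: `π^*g = t^w g'`), `c'` a unit, have `g' − c'·z'^w ∈ 𝓘(E)_y`
— the point round
`π^*z = t·z'` of the tree's `point_round_chart`, the shift law `giraud_point_shift`, and the colon calculus, `t` a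
non-zero-divisor.  (`w = n`: g24's `wInv_point_transport`; `w = 1`: lens-6's `absInv_point`.)
(Sources: Giraud1975; BravoGarciaEscamillaVillamayor2012, Lemma 4.6; EncinasVillamayor2000, Thm. 4.9; Hauser2010Kangaroo;
StacksProject, Tag 0BIQ.) -/
theorem cInv_point_transport (hπ : IsBlowup π C) [IsLocallyNoetherian X] [IsLocallyNoetherian X']
    (hX : Scheme.IsRegular X) (hCreg : Scheme.IsRegular C.subscheme) (I H : X.IdealSheafData) {w n : ℕ} (hwn : w ≤ n)
    (y : X') (hcl : IsClosed ({π y} : Set X)) (hpt : (C.support : Set X) = {π y})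
    (hIn : stalkIdeal I (π y) ≤ maximalIdeal _ ^ n)
    (hI' : stalkIdeal (controlledTransform π C I n) y ≤ maximalIdeal _ ^ (n - w + 1))
    (h : CInv w I H n (π y)) :
    ∃ z' : X'.presheaf.stalk y, stalkIdeal (strictTransformIdeal π C H) y = Ideal.span {z'} ∧
      z' ∈ maximalIdeal (X'.presheaf.stalk y) ∧ z' ∉ maximalIdeal (X'.presheaf.stalk y) ^ 2 ∧
      ∃ g' ∈ diffIdeal ℤ (n - w) (stalkIdeal (controlledTransform π C I n) y), ∃ c' : X'.presheaf.stalk y, IsUnit c' ∧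
        g' - c' * z' ^ w ∈ stalkIdeal (C.comap π) y := by
  obtain ⟨z, hHz, hz1, hz2, g, hgD, c, hc, hgz⟩ := h
  haveI : IsRegularLocalRing (X.presheaf.stalk (π y)) := hX _
  have hCst : stalkIdeal C (π y) = maximalIdeal _ := by
    rw [eq_vanishingIdeal_support_of_isRegular C hCreg]
    apply stalkIdeal_vanishingIdeal_eq_maximalIdeal_of_closure_eq
    rw [hpt, hcl.closure_eq]
  obtain ⟨𝔷, z', hE, hnzd, hzz', -, hreg⟩ := AbsoluteContactClasses.point_round_chart hπ y hCst hz1 hz2 hHz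
  set σ := (π.stalkMap y).hom with hσ
  set t := σ 𝔷 with ht
  have hEm : (maximalIdeal (X.presheaf.stalk (π y))).map σ = Ideal.span {t} := by
    rw [← hCst, ← stalkIdeal_comap_eq_map_stalkMap, hE]
  -- `g ∈ 𝔪_x^w`, so `π^* g = t^w · w₀`
  have hgw : g ∈ maximalIdeal _ ^ w := by
    have := diffIdeal_le_pow_sub ℤ hIn (n - w) hgD
    rwa [Nat.sub_sub_self hwn] at this
  have hσg : σ g ∈ Ideal.span {t ^ w} := by
    have hm : σ g ∈ (maximalIdeal _ ^ w).map σ := Ideal.mem_map_of_mem _ hgw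
    rwa [Ideal.map_pow, hEm, Ideal.span_singleton_pow] at hm
  obtain ⟨w₀, hw₀⟩ := Ideal.mem_span_singleton'.mp hσg
  -- GIRAUD: `w₀ ∈ Diff^{≤ n−w}(𝓘'_y)`
  have hw₀D : w₀ ∈ diffIdeal ℤ (n - w) (stalkIdeal (controlledTransform π C I n) y) :=
    giraud_point_shift hπ y hCst 𝔷 hE hnzd I (Nat.sub_le n w) hIn hgD
      (by rw [Nat.sub_sub_self hwn, ← hw₀, mul_comm])
  -- `π^*(g − c z^w) = b · t^{w+1}`
  have hσr : σ (g - c * z ^ w) ∈ Ideal.span {t ^ (w + 1)} := by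
    have hm : σ (g - c * z ^ w) ∈ (maximalIdeal _ ^ (w + 1)).map σ := Ideal.mem_map_of_mem _ hgz
    rwa [Ideal.map_pow, hEm, Ideal.span_singleton_pow] at hm
  obtain ⟨b, hb⟩ := Ideal.mem_span_singleton'.mp hσr
  have hkey : w₀ - σ c * z' ^ w = t * b := by
    have h1 : t ^ w * (w₀ - σ c * z' ^ w) = t ^ w * (t * b) := by
      have e1 : σ (g - c * z ^ w) = σ g - σ c * (t * z') ^ w := by rw [map_sub, map_mul, map_pow, hzz']
      calc t ^ w * (w₀ - σ c * z' ^ w) = w₀ * t ^ w - σ c * (t * z') ^ w := by ring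
        _ = σ (g - c * z ^ w) := by rw [e1, hw₀]
        _ = b * t ^ (w + 1) := hb.symm
        _ = t ^ w * (t * b) := by ring
    exact (mul_cancel_left_mem_nonZeroDivisors (pow_mem hnzd w)).mp h1
  have htm : t ∈ maximalIdeal (X'.presheaf.stalk y) := by
    have h1 : t ∈ (maximalIdeal (X.presheaf.stalk (π y))).map σ := by
      rw [hEm]; exact Ideal.mem_span_singleton_self t
    have hle : (maximalIdeal (X.presheaf.stalk (π y))).map σ ≤ maximalIdeal (X'.presheaf.stalk y) :=
      Ideal.map_le_iff_le_comap.mpr fun a ha => Ideal.mem_comap.mpr (map_nonunit σ a ha)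
    exact hle h1
  have hcu : IsUnit (σ c) := hc.map σ
  have hz'n : σ c * z' ^ w ∈ maximalIdeal (X'.presheaf.stalk y) := by
    have hw₀m : w₀ ∈ maximalIdeal _ := diffIdeal_le_of_le_pow_succ ℤ (n := n - w) hI' hw₀D
    have h1 : w₀ - t * b ∈ maximalIdeal _ := sub_mem hw₀m (Ideal.mul_mem_right _ _ htm)
    have e : w₀ - t * b = σ c * z' ^ w := by rw [← hkey]; ring
    rwa [e] at h1
  have hz'm : z' ∈ maximalIdeal (X'.presheaf.stalk y) :=
    Ideal.IsPrime.mem_of_pow_mem inferInstance w ((Ideal.unit_mul_mem_iff_mem _ hcu).mp hz'n)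
  obtain ⟨hz'2, hprime, htz'⟩ := hreg hz'm
  refine ⟨z', ?_, hz'm, hz'2, w₀, hw₀D, σ c, hcu, ?_⟩
  · rw [stalkIdeal_strictTransformIdeal π C H y, hHz, Ideal.map_span, Set.image_singleton, hzz', hE]
    apply le_antisymm
    · refine iSup_le fun m => fun a ha => ?_
      have h1 : a * t ^ m ∈ Ideal.span {z'} := by
        have h2 : a * t ^ m ∈ Ideal.span {t * z'} :=
          Submodule.mem_colon.mp ha (t ^ m) (Ideal.pow_mem_pow (Ideal.mem_span_singleton_self _) m)
        exact Ideal.span_singleton_le_iff_mem _ |>.mpr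
          (Ideal.mul_mem_left _ t (Ideal.mem_span_singleton_self z')) h2
      rcases hprime.mem_or_mem h1 with h3 | h3
      · exact h3
      · exact absurd (hprime.mem_of_pow_mem m h3) htz'
    · refine le_iSup_of_le 1 fun a ha => ?_
      obtain ⟨c₁, rfl⟩ := Ideal.mem_span_singleton'.mp ha
      refine Submodule.mem_colon.mpr fun s hs => ?_
      rw [pow_one] at hs
      obtain ⟨b₁, rfl⟩ := Ideal.mem_span_singleton'.mp hs
      rw [smul_eq_mul, show c₁ * z' * (b₁ * t) = (c₁ * b₁) * (t * z') by ring]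
      exact Ideal.mul_mem_left _ _ (Ideal.mem_span_singleton_self _)
  · rw [hkey, hE]
    exact Ideal.mul_mem_right _ _ (Ideal.mem_span_singleton_self _)

/-- **THE COMPANION DICHOTOMY AT THE NEXT POINT (KERNEL, PROVED)**: after one point blow-up the companion invariant EITHER
PERSISTS along the strict transform (`CInv w 𝓘' H' n y`) OR there is a TYPED COMPANION JUMP (`CTailJumpAt w 𝓘'
H' 𝓘(E) n y`).
(Sources: Giraud1975; Hauser2010Kangaroo; Moh1987.) -/
theorem cInv_or_cTailJumpAt_point (hπ : IsBlowup π C) [IsLocallyNoetherian X] [IsLocallyNoetherian X']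
    (hX : Scheme.IsRegular X) (hCreg : Scheme.IsRegular C.subscheme) (I H : X.IdealSheafData) {w n : ℕ} (hwn : w ≤ n)
    (y : X') (hcl : IsClosed ({π y} : Set X)) (hpt : (C.support : Set X) = {π y})
    (hIn : stalkIdeal I (π y) ≤ maximalIdeal _ ^ n)
    (hI' : stalkIdeal (controlledTransform π C I n) y ≤ maximalIdeal _ ^ (n - w + 1))
    (h : CInv w I H n (π y)) :
    CInv w (controlledTransform π C I n) (strictTransformIdeal π C H) n y ∨
      CTailJumpAt w (controlledTransform π C I n) (strictTransformIdeal π C H) (C.comap π) n y := by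
  obtain ⟨z', hH', hz'm, hz'2, g', hg', c', hc', hgz⟩ := cInv_point_transport hπ hX hCreg I H hwn y hcl hpt hIn hI' h
  by_cases hj : g' - c' * z' ^ w ∈ maximalIdeal (X'.presheaf.stalk y) ^ (w + 1)
  · exact Or.inl ⟨z', hH', hz'm, hz'2, g', hg', c', hc', hj⟩
  · exact Or.inr ⟨z', hH', hz'm, hz'2, g', hg', c', hc', hgz, hj⟩

end CompanionTransport

end Summit.ResolutionOfSingularities.ResolutionOfSingularities.Theorems.HugValuationCut
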